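import Summits.FinalStateConjecture.FinalStateConjecture.Theorems.EIHFluxBalanceInertialRecessionStubChargeModelKSCharge

/-!
# Route EIHFluxBalance — `InertialRecession`, line `sublinear-is-free-clean-window-charges`:
# the Landau–Lifshitz linear momentum of a static Schwarzschild sphere vanishes
# (helpers for `stub_chargeModel`, identification half)

Helper file (`--supports stmt-FinalStateConjecture-10166`) for the crux
`Summit.FinalStateConjecture.FinalStateConjecture.Theses.EIHFluxBalance.InertialRecession`.

Companion of `…KSCharge` (energy flux density `h^{00j} = Mxⱼ/(4πr³)`): for the static Schwarzschild
Kerr–Schild components `g_{M,0}`, off the time axis,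

* `superpotential_schwarzschild_momentum_zero/_succ` — `H^{k00j} = (1 + 2M/r)δ_{kj} − 2Mx_kxⱼ/r³`,
  `H^{ki0j} = 2M(x_kδ_{ij} − x_iδ_{kj})/r²`;
* `hField_schwarzschild_momentum` — **the momentum flux density** `h^{k0j} = −M x_k xⱼ/(4πr⁴)`
  (even under `x~ ↦ −x~`);
* `quasiLocalMomentum_schwarzschild_momentum` — **`P^k(t; 0, R) = 0`** for every `R > 0`: the
  integrand `Σⱼ h^{k0j} nⱼ` is odd under the point reflection through the centre
  (`LandauLifshitz.setIntegral_sphere_eq_zero_of_odd`).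

Together with `…KSEnergy`: the LL four-momentum of every coordinate sphere about a static hole is
`(M, 0, 0, 0) = M u_hole` exactly.
-/

set_option linter.dupNamespace false
-- instance search on the nested operator spaces needs a deeper pending depth (as in `CoordCurvature.lean`)
set_option maxSynthPendingDepth 3

noncomputable section

open scoped Matrix BigOperators Topology
open Filter Set Metric MeasureTheory Literature.Geometry.Lorentzian Literature.Geometry.Lorentzian.LandauLifshitz

namespace Summit.FinalStateConjecture.FinalStateConjecture.Theorems

namespace KSCharge

/-- Coordinates of the coordinate vectors: `(∂_μ)^ν = δ_μ^ν` (local copy). [folklore] -/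
private theorem basisVector_apply' (μ ν : Fin 4) : E4.basisVector μ ν = if ν = μ then 1 else 0 := by
  simp [E4.basisVector]

/-! ### The momentum components of the superpotential -/

/-- `H^{k00j} = (1 + 2M/r) δ_{kj} − 2M x_k xⱼ / r³` off the time axis. [cite: LandauLifshitz1975, §96 (96.3)] -/
theorem superpotential_schwarzschild_momentum_zero (M : ℝ) {x : E4} (hx : E4.spatial x ≠ 0) (k j : Fin 3) :
    superpotential (fun y ↦ Kerr.bilin M 0 y) x k.succ 0 0 j.succ =
      (1 + 2 * M / E4.spatialNorm x ^ 1) * (if k = j then (1 : ℝ) else 0) -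
        (x k.succ * x j.succ) * (2 * M / E4.spatialNorm x ^ 3) := by
  have hr : E4.spatialNorm x ≠ 0 := by
    rw [E4.spatialNorm]; exact norm_ne_zero_iff.2 hx
  rw [superpotential, KSMatrix.metricDet_kerr M 0 (radius_pos_of_spatial_ne_zero hx)]
  simp only [upper_schwarzschild_apply M hx]
  fin_cases k <;> fin_cases j <;> simp [Matrix.diagonal] <;> field_simp <;> ring

/-- `H^{ki0j} = 2M (x_k δ_{ij} − x_i δ_{kj}) / r²` off the time axis (the `H²` terms cancel).
[cite: LandauLifshitz1975, §96 (96.3)] -/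
theorem superpotential_schwarzschild_momentum_succ (M : ℝ) {x : E4} (hx : E4.spatial x ≠ 0) (k i j : Fin 3) :
    superpotential (fun y ↦ Kerr.bilin M 0 y) x k.succ i.succ 0 j.succ =
      (x k.succ * (if i = j then (1 : ℝ) else 0) - x i.succ * (if k = j then (1 : ℝ) else 0)) *
        (2 * M / E4.spatialNorm x ^ 2) := by
  have hr : E4.spatialNorm x ≠ 0 := by
    rw [E4.spatialNorm]; exact norm_ne_zero_iff.2 hx
  rw [superpotential, KSMatrix.metricDet_kerr M 0 (radius_pos_of_spatial_ne_zero hx)]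
  simp only [upper_schwarzschild_apply M hx]
  fin_cases k <;> fin_cases i <;> fin_cases j <;> simp [Matrix.diagonal] <;> field_simp <;> ring

/-! ### Their derivatives -/

/-- The spatial pairing with the time coordinate vector vanishes: `⟪x~, (∂₀)~⟫ = 0`. [folklore] -/
theorem sdot_basisVector_zero (x : E4) : Schwarzschild.sdot x (E4.basisVector 0) = 0 := by
  rw [Schwarzschild.sdot, Kerr.inner_spatial_eq]
  simp [E4.basisVector]

/-- The `∂₀`-derivative of the static component `y ↦ (1 + 2M/r)δ − y_k yⱼ (2M/r³)` vanishes.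
[folklore] -/
theorem fderiv_superpotentialMomentumZero_apply (M : ℝ) {x : E4} (hx : E4.spatial x ≠ 0) (k j : Fin 3) :
    fderiv ℝ (fun y : E4 ↦ (1 + 2 * M / E4.spatialNorm y ^ 1) * (if k = j then (1 : ℝ) else 0) -
        (y k.succ * y j.succ) * (2 * M / E4.spatialNorm y ^ 3)) x (E4.basisVector 0) = 0 := by
  have h₁ := Schwarzschild.hasFDerivAt_const_div_spatialNorm_pow (2 * M) hx 1
  have h₃ := Schwarzschild.hasFDerivAt_const_div_spatialNorm_pow (2 * M) hx 3
  have hc : ∀ m : Fin 4, HasFDerivAt (fun y : E4 ↦ y m) (EuclideanSpace.proj m : E4 →L[ℝ] ℝ) x := fun m ↦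
    (EuclideanSpace.proj m : E4 →L[ℝ] ℝ).hasFDerivAt
  have hS : HasFDerivAt (fun y : E4 ↦ (1 + 2 * M / E4.spatialNorm y ^ 1) * (if k = j then (1 : ℝ) else 0) -
      (y k.succ * y j.succ) * (2 * M / E4.spatialNorm y ^ 3)) _ x :=
    ((h₁.const_add 1).mul_const (if k = j then (1 : ℝ) else 0)).sub (((hc k.succ).mul (hc j.succ)).mul h₃)
  rw [hS.fderiv]
  simp only [sub_apply, add_apply, smul_apply, smul_eq_mul, Schwarzschild.sdotCLM_apply,
    sdot_basisVector_zero, Pi.mul_apply]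
  have hp : ∀ m : Fin 3, (EuclideanSpace.proj m.succ : E4 →L[ℝ] ℝ) (E4.basisVector 0) = 0 := fun m ↦ by
    rw [show (EuclideanSpace.proj m.succ : E4 →L[ℝ] ℝ) (E4.basisVector 0) = E4.basisVector 0 m.succ from rfl,
      basisVector_apply']
    simp only [Fin.succ_ne_zero, if_false]
  rw [hp, hp]
  ring

/-- The `∂_{l+1}`-derivative of the component `y ↦ (y_k δ_{ij} − y_i δ_{kj}) (2M/r²)`:
`(δ_{kl} δ_{ij} − δ_{il} δ_{kj}) 2M/r² − (x_k δ_{ij} − x_i δ_{kj}) 4M x_l / r⁴`. [folklore] -/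
theorem fderiv_superpotentialMomentumSucc_apply (M : ℝ) {x : E4} (hx : E4.spatial x ≠ 0) (k i j l : Fin 3) :
    fderiv ℝ (fun y : E4 ↦ (y k.succ * (if i = j then (1 : ℝ) else 0) - y i.succ * (if k = j then (1 : ℝ) else 0)) *
        (2 * M / E4.spatialNorm y ^ 2)) x (E4.basisVector l.succ) =
      ((if k = l then (1 : ℝ) else 0) * (if i = j then (1 : ℝ) else 0) -
          (if i = l then (1 : ℝ) else 0) * (if k = j then (1 : ℝ) else 0)) * (2 * M / E4.spatialNorm x ^ 2) -
        (x k.succ * (if i = j then (1 : ℝ) else 0) - x i.succ * (if k = j then (1 : ℝ) else 0)) *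
          (4 * M * x l.succ / E4.spatialNorm x ^ 4) := by
  have h₂ := Schwarzschild.hasFDerivAt_const_div_spatialNorm_pow (2 * M) hx 2
  have hc : ∀ m : Fin 4, HasFDerivAt (fun y : E4 ↦ y m) (EuclideanSpace.proj m : E4 →L[ℝ] ℝ) x := fun m ↦
    (EuclideanSpace.proj m : E4 →L[ℝ] ℝ).hasFDerivAt
  have hS : HasFDerivAt (fun y : E4 ↦ (y k.succ * (if i = j then (1 : ℝ) else 0) -
      y i.succ * (if k = j then (1 : ℝ) else 0)) * (2 * M / E4.spatialNorm y ^ 2)) _ x :=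
    (((hc k.succ).mul_const (if i = j then (1 : ℝ) else 0)).sub
      ((hc i.succ).mul_const (if k = j then (1 : ℝ) else 0))).mul h₂
  rw [hS.fderiv]
  simp only [sub_apply, add_apply, smul_apply, smul_eq_mul, Schwarzschild.sdotCLM_apply,
    sdot_basisVector_succ, Pi.sub_apply]
  have hp : ∀ m : Fin 4, (EuclideanSpace.proj m : E4 →L[ℝ] ℝ) (E4.basisVector l.succ) =
      if m = l.succ then 1 else 0 := fun m ↦ by
    rw [show (EuclideanSpace.proj m : E4 →L[ℝ] ℝ) (E4.basisVector l.succ) = E4.basisVector l.succ m from rfl,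
      basisVector_apply']
  rw [hp, hp]
  have hkl : (k.succ = l.succ) = (k = l) := by rw [Fin.succ_inj]
  have hil : (i.succ = l.succ) = (i = l) := by rw [Fin.succ_inj]
  simp only [hkl, hil]
  push_cast
  ring

/-- The contraction `Σᵢ ∂ᵢ H^{ki0j}` of the explicit components: `−4M x_k xⱼ / r⁴`. [folklore] -/
theorem sum_fderiv_superpotentialMomentumSucc (M : ℝ) {x : E4} (hx : E4.spatial x ≠ 0) (k j : Fin 3) :
    ∑ i : Fin 3, fderiv ℝ (fun y : E4 ↦ (y k.succ * (if i = j then (1 : ℝ) else 0) -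
        y i.succ * (if k = j then (1 : ℝ) else 0)) * (2 * M / E4.spatialNorm y ^ 2)) x (E4.basisVector i.succ) =
      -(4 * M * (x k.succ * x j.succ)) / E4.spatialNorm x ^ 4 := by
  have hr : E4.spatialNorm x ≠ 0 := by
    rw [E4.spatialNorm]; exact norm_ne_zero_iff.2 hx
  have hsq := E4.spatialNorm_sq x
  simp only [fderiv_superpotentialMomentumSucc_apply M hx]
  rw [Fin.sum_univ_three]
  fin_cases k <;> fin_cases j <;> simp <;> field_simp <;> linear_combination (-4 * M) * hsq


/-! ### The momentum flux density and the vanishing of the momentum -/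

/-- **The Landau–Lifshitz momentum flux density of the static Schwarzschild Kerr–Schild field**:
off the time axis, `h^{k0j}(x) = −M x_k xⱼ / (4π r⁴)` (`∂₀H^{k00j} = 0`, `Σᵢ ∂ᵢ H^{ki0j} = −4Mx_kxⱼ/r⁴`).
[cite: LandauLifshitz1975, §96 (96.2)] -/
theorem hField_schwarzschild_momentum (M : ℝ) {x : E4} (hx : E4.spatial x ≠ 0) (k j : Fin 3) :
    hField (fun y ↦ Kerr.bilin M 0 y) x k.succ 0 j.succ =
      -(M * (x k.succ * x j.succ)) / (4 * Real.pi * E4.spatialNorm x ^ 4) := by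
  have hr : E4.spatialNorm x ≠ 0 := by
    rw [E4.spatialNorm]; exact norm_ne_zero_iff.2 hx
  rw [hField, Fin.sum_univ_succ]
  have h0 : partialDeriv 0 (fun y ↦ superpotential (fun y ↦ Kerr.bilin M 0 y) y k.succ 0 0 j.succ) x =
      fderiv ℝ (fun y : E4 ↦ (1 + 2 * M / E4.spatialNorm y ^ 1) * (if k = j then (1 : ℝ) else 0) -
        (y k.succ * y j.succ) * (2 * M / E4.spatialNorm y ^ 3)) x (E4.basisVector 0) := by
    rw [partialDeriv]
    congr 1
    refine Filter.EventuallyEq.fderiv_eq ?_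
    filter_upwards [Schwarzschild.isOpen_spatial_ne_zero.mem_nhds hx] with y hy
    rw [superpotential_schwarzschild_momentum_zero M hy]
  have hi : ∀ i : Fin 3, partialDeriv i.succ (fun y ↦ superpotential (fun y ↦ Kerr.bilin M 0 y) y k.succ i.succ 0 j.succ) x =
      fderiv ℝ (fun y : E4 ↦ (y k.succ * (if i = j then (1 : ℝ) else 0) -
        y i.succ * (if k = j then (1 : ℝ) else 0)) * (2 * M / E4.spatialNorm y ^ 2)) x (E4.basisVector i.succ) := by
    intro i
    rw [partialDeriv]
    congr 1
    refine Filter.EventuallyEq.fderiv_eq ?_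
    filter_upwards [Schwarzschild.isOpen_spatial_ne_zero.mem_nhds hx] with y hy
    rw [superpotential_schwarzschild_momentum_succ M hy]
  rw [h0, fderiv_superpotentialMomentumZero_apply M hx, zero_add]
  simp only [hi, sum_fderiv_superpotentialMomentumSucc M hx]
  have hπ : Real.pi ≠ 0 := Real.pi_ne_zero
  field_simp
  ring

/-- The momentum flux density is EVEN under the spatial point reflection through the hole:
`h^{k0j}(t, −y) = h^{k0j}(t, y)` for `y ≠ 0`. [folklore] -/
theorem hField_schwarzschild_momentum_neg (M t : ℝ) {y : E3} (hy : y ≠ 0) (k j : Fin 3) :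
    hField (fun z ↦ Kerr.bilin M 0 z) (E4.ofTimeSpace t (-y)) k.succ 0 j.succ =
      hField (fun z ↦ Kerr.bilin M 0 z) (E4.ofTimeSpace t y) k.succ 0 j.succ := by
  have hx : E4.spatial (E4.ofTimeSpace t y) ≠ 0 := by rwa [E4.spatial_ofTimeSpace]
  have hx' : E4.spatial (E4.ofTimeSpace t (-y)) ≠ 0 := by rwa [E4.spatial_ofTimeSpace, neg_ne_zero]
  rw [hField_schwarzschild_momentum M hx, hField_schwarzschild_momentum M hx',
    E4.spatialNorm_ofTimeSpace, E4.spatialNorm_ofTimeSpace, norm_neg]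
  simp only [E4.ofTimeSpace_apply_succ, PiLp.neg_apply, neg_mul_neg]

/-- **The Landau–Lifshitz linear momentum of every coordinate sphere about a static Schwarzschild hole
vanishes**: `P^k(t; 0, R) = 0` for all `t`, `R` (the integrand `Σⱼ h^{k0j} yⱼ/R` is odd under the point
reflection `y ↦ −y`, `LandauLifshitz.setIntegral_sphere_eq_zero_of_odd`). [cite: LandauLifshitz1975, §96 (96.16)] -/
theorem quasiLocalMomentum_schwarzschild_momentum (M t R : ℝ) (k : Fin 3) :
    quasiLocalMomentum (fun y ↦ Kerr.bilin M 0 y) t 0 R k.succ = 0 := by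
  rw [quasiLocalMomentum]
  refine setIntegral_sphere_eq_zero_of_odd fun y ↦ ?_
  have hrefl : (AffineIsometryEquiv.pointReflection ℝ (0 : E3)) y = -y := by
    simp [AffineIsometryEquiv.pointReflection_apply]
  rw [hrefl, ← Finset.sum_neg_distrib]
  refine Finset.sum_congr rfl fun j _ ↦ ?_
  by_cases hy : y = 0
  · simp [hy]
  · rw [hField_schwarzschild_momentum_neg M t hy]
    simp only [sub_zero, PiLp.neg_apply]
    ring

end KSCharge

/-- Registered sub-goal form (stub `quasiLocalMomentum_schwarzschild_eq_zero` of the crux item) of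
`KSCharge.quasiLocalMomentum_schwarzschild_momentum`: the Landau–Lifshitz linear momentum of every
coordinate sphere about a static Schwarzschild hole (Kerr–Schild components) vanishes.
[cite: LandauLifshitz1975, §96 (96.16)] -/
theorem quasiLocalMomentum_schwarzschild_eq_zero : open Literature.Geometry.Lorentzian in ∀ (M t R : ℝ) (k : Fin 3), LandauLifshitz.quasiLocalMomentum (fun y ↦ Kerr.bilin M 0 y) t 0 R k.succ = 0 :=
  KSCharge.quasiLocalMomentum_schwarzschild_momentum

end Summit.FinalStateConjecture.FinalStateConjecture.Theorems

end
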